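import Mathlib
import Summits.ResolutionOfSingularities.ResolutionOfSingularities.Theorems.FrobeniusClosingPatchingRelPerfectPointBlowupChartIterate

/-!
# TOT2-LINE (P3) brick B4, kernel part 2: the MONOMIAL CHART MAPS `Φ_ε : (x, v, w) ↦ (x, x^{ε₁} v, x^{ε₂} w)` of `k⟦x,v,w⟧`

Sub-problem `ResolutionOfSingularities`, ENGINE crux `stmt-ResolutionOfSingularities-8899` (`LocalWeightedDrop`), skeleton v35
(2e806da509994632), registered stub `stub_conflictBudget` (P3), bricks B4-1 … B4-4 of `L/res-L1-w43-stub-2/g6/P3_split_v1.lean`.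
[OURS · L1 W4.3 · chain w43 · res-L1-w43-lead-1 g6; def-free; nothing here is a statement of any manuscript; AI-produced, gate-checked,
weaker than expert review.]

The four chart maps of the budget transport (`u₁`-chart `(x, xv, xw)`, curve charts `(x, v, xw)`, and their swaps) are, up to the
permutation `x ↔ v`, the substitutions `Φ_ε` with `a 0 = X 0`, `a 1 = X 0 ^ ε₁ * X 1`, `a 2 = X 0 ^ ε₂ * X 2`.  This file is their
monomial calculus: `Φ_ε` maps the monomial `X^A` to `X^{A + (ε₁A₁+ε₂A₂)e₀}` (`prod_pow_eq_monomial`), is injective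
(`substAlgHom_injective`), fixes the series in `x` alone (`substAlgHom_rename_zero`), multiplies a box polynomial
`Σ r_{ij}(x) v^i w^j` termwise by `x^{ε₁ i + ε₂ j}` (`substAlgHom_boxSum`); box polynomials have no monomial outside their box
(`coeff_boxSum_eq_zero_of_le_fst/snd`); pure `v`-coefficients are read by killing `x, w` (`coeff_single_one_eq_coeff_killCompl`);
and the power rule `pow_mem_span_pow_sup` (from the tree's `Ideal.sup_pow_le_pow_sup`).
-/

set_option linter.dupNamespace false -- mandated namespace of this single-conjunct summit

noncomputable section

namespace Summit.ResolutionOfSingularities.ResolutionOfSingularities.Theorems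

namespace TOT2Chart

open MvPowerSeries IsLocalRing

variable {k : Type} [Field k]

/-! ## §1 Ideal bookkeeping -/

/-- A power of an element of `J ⊔ (x)` lies in `(its power) ⊔ (x)`: `g ∈ J ⊔ span {t}` ⇒ `g ^ N ∈ span {g ^ N}`-free form used below:
if `g - h ∈ span {t}` then `g ^ N ∈ span {h ^ N} ⊔ span {t}`. -/
theorem pow_mem_span_pow_sup {R : Type*} [CommRing R] {g h t : R} (hgh : g - h ∈ Ideal.span {t}) (N : ℕ) :
    g ^ N ∈ Ideal.span {h ^ N} ⊔ Ideal.span {t} := by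
  have hg : g ∈ Ideal.span {h} ⊔ Ideal.span {t} := by
    have : g = h + (g - h) := by ring
    rw [this]
    exact Submodule.add_mem_sup (Ideal.mem_span_singleton_self h) hgh
  have h1 := Ideal.pow_mem_pow hg N
  rw [← Ideal.span_singleton_pow]
  exact Ideal.sup_pow_le_pow_sup _ _ N h1

/-! ## §2 Series in `x` alone, box polynomials and their supports -/

/-- A series in `x` alone is its constant term plus a multiple of `x`. -/
theorem exists_rename_zero_eq_C_add_X_mul (r : MvPowerSeries (Fin 1) k) :
    ∃ q : MvPowerSeries (Fin 3) k, rename (fun _ : Fin 1 => (0 : Fin 3)) r = C (constantCoeff r) + X 0 * q := by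
  have hdvd : (X 0 : MvPowerSeries (Fin 1) k) ∣ r - C (constantCoeff r) := by
    rw [X_dvd_iff]
    intro m hm
    have hm0 : m = 0 := Finsupp.ext fun i => by fin_cases i; simpa using hm
    rw [hm0, map_sub, coeff_zero_eq_constantCoeff, constantCoeff_C, sub_self]
  obtain ⟨q, hq⟩ := hdvd
  refine ⟨rename (fun _ : Fin 1 => (0 : Fin 3)) q, ?_⟩
  have : r = C (constantCoeff r) + X 0 * q := by rw [← hq]; ring
  conv_lhs => rw [this]
  rw [map_add, map_mul, rename_C, rename_X]

/-- Coefficients of a series in `x` alone vanish off the `x`-axis. -/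
theorem coeff_rename_zero_eq_zero {r : MvPowerSeries (Fin 1) k} {n : Fin 3 →₀ ℕ} (hn : n 1 ≠ 0 ∨ n 2 ≠ 0) :
    coeff n (rename (fun _ : Fin 1 => (0 : Fin 3)) r) = 0 := by
  classical
  apply coeff_rename_eq_zero
  rintro ⟨u, hu⟩
  rcases hn with h | h
  · apply h
    rw [← hu]
    exact Finsupp.mapDomain_notin_range _ _ (by rintro ⟨_, h0⟩; exact Fin.zero_ne_one h0)
  · apply h
    rw [← hu]
    refine Finsupp.mapDomain_notin_range _ _ (by rintro ⟨_, h0⟩; exact (show (0 : Fin 3) ≠ 2 by decide) h0)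

/-- A term `r(x)·x^e·v^i w^j` has no monomial off `v`-degree `i`, `w`-degree `j`. -/
theorem coeff_term_eq_zero {r : MvPowerSeries (Fin 1) k} {e i j : ℕ} {E : Fin 3 →₀ ℕ} (hE : E 1 ≠ i ∨ E 2 ≠ j) :
    coeff E (rename (fun _ : Fin 1 => (0 : Fin 3)) r * X 0 ^ e * (X 1 ^ i * X 2 ^ j)) = 0 := by
  classical
  have hx : rename (fun _ : Fin 1 => (0 : Fin 3)) r * X 0 ^ e = rename (fun _ : Fin 1 => (0 : Fin 3)) (r * X 0 ^ e) := by
    rw [map_mul, map_pow, rename_X]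
  have hmono : (X 1 ^ i * X 2 ^ j : MvPowerSeries (Fin 3) k) = monomial (Finsupp.single 1 i + Finsupp.single 2 j) 1 := by
    rw [X_pow_eq, X_pow_eq, monomial_mul_monomial, one_mul]
  rw [hx, hmono, coeff_mul_monomial, mul_one]
  split_ifs with hle
  · apply coeff_rename_zero_eq_zero
    have h1 : (Finsupp.single (1 : Fin 3) i + Finsupp.single (2 : Fin 3) j : Fin 3 →₀ ℕ) 1 = i := by simp
    have h2 : (Finsupp.single (1 : Fin 3) i + Finsupp.single (2 : Fin 3) j : Fin 3 →₀ ℕ) 2 = j := by simp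
    have hle1 := hle 1
    have hle2 := hle 2
    rw [h1] at hle1
    rw [h2] at hle2
    rcases hE with h | h
    · left; rw [Finsupp.tsub_apply, h1]; omega
    · right; rw [Finsupp.tsub_apply, h2]; omega
  · rfl

/-- **A box polynomial `Σ_{(i,j) ∈ box} r_{ij}(x) x^{e_{ij}} v^i w^j` has no monomial of `v`-degree `≥ α`** when every `i < α`. -/
theorem coeff_boxSum_eq_zero_of_le_fst {ι : Type} [Fintype ι] (c : ι → MvPowerSeries (Fin 1) k) (e i j : ι → ℕ) {α : ℕ}
    (hi : ∀ p, i p < α) {E : Fin 3 →₀ ℕ} (hE : α ≤ E 1) :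
    coeff E (∑ p, rename (fun _ : Fin 1 => (0 : Fin 3)) (c p) * X 0 ^ (e p) * (X 1 ^ (i p) * X 2 ^ (j p))) = 0 := by
  rw [map_sum]
  exact Finset.sum_eq_zero fun p _ => coeff_term_eq_zero (Or.inl (by have := hi p; omega))

/-- Same for the `w`-degree. -/
theorem coeff_boxSum_eq_zero_of_le_snd {ι : Type} [Fintype ι] (c : ι → MvPowerSeries (Fin 1) k) (e i j : ι → ℕ) {β : ℕ}
    (hj : ∀ p, j p < β) {E : Fin 3 →₀ ℕ} (hE : β ≤ E 2) :
    coeff E (∑ p, rename (fun _ : Fin 1 => (0 : Fin 3)) (c p) * X 0 ^ (e p) * (X 1 ^ (i p) * X 2 ^ (j p))) = 0 := by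
  rw [map_sum]
  exact Finset.sum_eq_zero fun p _ => coeff_term_eq_zero (Or.inr (by have := hj p; omega))

/-! ## §3 Pure coefficients along one variable are read by killing the others -/

/-- The pure `X s`-coefficients of a series are the coefficients of its image under `killCompl` along `(⋆ ↦ s) : Fin 1 ↪ Fin 3`. -/
theorem coeff_single_eq_coeff_killCompl (s : Fin 3) (G : MvPowerSeries (Fin 3) k) (n : ℕ) :
    coeff (Finsupp.single s n) G =
      coeff (Finsupp.single (0 : Fin 1) n) (killCompl (⟨fun _ : Fin 1 => s, fun a b _ => Subsingleton.elim a b⟩ : Fin 1 ↪ Fin 3) G) := by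
  rw [coeff_killCompl, Finsupp.embDomain_single]
  rfl

/-- `killCompl` along `⋆ ↦ s` kills the other variables. -/
theorem killCompl_X_of_ne {s t : Fin 3} (hst : t ≠ s) :
    killCompl (R := k) (⟨fun _ : Fin 1 => s, fun a b _ => Subsingleton.elim a b⟩ : Fin 1 ↪ Fin 3) (X t) = 0 :=
  killCompl_X_eq_zero (by rintro ⟨u, hu⟩; exact hst hu.symm)

/-- `killCompl` along `⋆ ↦ s` keeps `X s`. -/
theorem killCompl_X_self (s : Fin 3) :
    killCompl (R := k) (⟨fun _ : Fin 1 => s, fun a b _ => Subsingleton.elim a b⟩ : Fin 1 ↪ Fin 3) (X s) = X 0 :=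
  killCompl_X (R := k) (e := (⟨fun _ : Fin 1 => s, fun a b _ => Subsingleton.elim a b⟩ : Fin 1 ↪ Fin 3)) 0

/-- Killing `x` (and another variable) sends a series in `x` alone with zero constant term to `0`. -/
theorem killCompl_rename_zero_of_constantCoeff {s : Fin 3} (hs : s ≠ 0) {r : MvPowerSeries (Fin 1) k} (hr : constantCoeff r = 0) :
    killCompl (R := k) (⟨fun _ : Fin 1 => s, fun a b _ => Subsingleton.elim a b⟩ : Fin 1 ↪ Fin 3)
      (rename (fun _ : Fin 1 => (0 : Fin 3)) r) = 0 := by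
  obtain ⟨q, hq⟩ := exists_rename_zero_eq_C_add_X_mul r
  rw [hq, hr, map_zero, zero_add, map_mul, killCompl_X_of_ne hs.symm, zero_mul]

/-- **The pure `X s`-coefficients of a power of a monic Weierstrass element** `X s ^ α + Σ_j r_j(x) x^{e_j} (X s)^j` (`r_j(0) = 0`,
`s ≠ 0`): those of `X s ^ (α N)`. -/
theorem coeff_single_pow_weierstrass {s : Fin 3} (hs : s ≠ 0) {α : ℕ} (r : Fin α → MvPowerSeries (Fin 1) k)
    (hr : ∀ j, constantCoeff (r j) = 0) (e : Fin α → ℕ) (N n : ℕ) :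
    coeff (Finsupp.single s n) ((X s ^ α + ∑ j, rename (fun _ : Fin 1 => (0 : Fin 3)) (r j) * X 0 ^ (e j) * X s ^ (j : ℕ)) ^ N) =
      if n = α * N then 1 else 0 := by
  classical
  set κ := killCompl (R := k) (⟨fun _ : Fin 1 => s, fun a b _ => Subsingleton.elim a b⟩ : Fin 1 ↪ Fin 3) with hκ
  have hW : κ (X s ^ α + ∑ j, rename (fun _ : Fin 1 => (0 : Fin 3)) (r j) * X 0 ^ (e j) * X s ^ (j : ℕ)) = X 0 ^ α := by
    rw [map_add, map_pow, hκ, killCompl_X_self, map_sum, Finset.sum_eq_zero (fun j _ => by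
      rw [map_mul, map_mul, killCompl_rename_zero_of_constantCoeff hs (hr j), zero_mul, zero_mul]), add_zero]
  rw [coeff_single_eq_coeff_killCompl, ← hκ, map_pow κ, hW, ← pow_mul, coeff_X_pow]
  by_cases h : n = α * N
  · rw [if_pos (by rw [h]), if_pos h]
  · rw [if_neg h, if_neg (fun h' => h (Finsupp.single_injective _ h'))]

/-! ## §4 The chart substitution `Φ_ε` -/

section Chart

variable {a : Fin 3 → MvPowerSeries (Fin 3) k} (ha : HasSubst a) {ε₁ ε₂ : ℕ}
  (h0 : a 0 = X 0) (h1 : a 1 = X 0 ^ ε₁ * X 1) (h2 : a 2 = X 0 ^ ε₂ * X 2)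
include h0 h1 h2

/-- `Φ_ε` on monomials: `X^A ↦ X^{A + (ε₁ A₁ + ε₂ A₂) e₀}`. -/
theorem prod_pow_eq_monomial (A : Fin 3 →₀ ℕ) :
    (A.prod fun s m => a s ^ m) = monomial (A + Finsupp.single 0 (ε₁ * A 1 + ε₂ * A 2)) 1 := by
  rw [Finsupp.prod_fintype _ _ (fun _ => pow_zero _), Fin.prod_univ_three, h0, h1, h2]
  calc (X 0 : MvPowerSeries (Fin 3) k) ^ A 0 * (X 0 ^ ε₁ * X 1) ^ A 1 * (X 0 ^ ε₂ * X 2) ^ A 2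
        = X 0 ^ (A 0 + ε₁ * A 1 + ε₂ * A 2) * X 1 ^ A 1 * X 2 ^ A 2 := by ring
    _ = monomial (A + Finsupp.single 0 (ε₁ * A 1 + ε₂ * A 2)) 1 := by
        have hA : Finsupp.single (0 : Fin 3) (A 0 + ε₁ * A 1 + ε₂ * A 2) + Finsupp.single 1 (A 1) + Finsupp.single 2 (A 2) =
            A + Finsupp.single 0 (ε₁ * A 1 + ε₂ * A 2) := by
          refine Finsupp.ext fun i => ?_
          fin_cases i <;> simp
          omega
        rw [X_pow_eq, X_pow_eq, X_pow_eq, monomial_mul_monomial, monomial_mul_monomial, one_mul, one_mul, hA]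

omit h0 h1 h2 in
/-- The exponent map of `Φ_ε` is injective. -/
theorem chartExp_injective : Function.Injective (fun A : Fin 3 →₀ ℕ => A + Finsupp.single 0 (ε₁ * A 1 + ε₂ * A 2)) := by
  intro A B hAB
  have h1' : A 1 = B 1 := by have := DFunLike.congr_fun hAB 1; simpa using this
  have h2' : A 2 = B 2 := by have := DFunLike.congr_fun hAB 2; simpa using this
  have h0' : A 0 = B 0 := by
    have := DFunLike.congr_fun hAB 0
    simp only [Finsupp.coe_add, Pi.add_apply, Finsupp.single_eq_same] at this
    rw [h1', h2'] at this
    omega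
  ext i; fin_cases i
  · exact h0'
  · exact h1'
  · exact h2'

/-- Coefficients are transported along `Φ_ε`. -/
theorem coeff_chartExp_substAlgHom (F : MvPowerSeries (Fin 3) k) (A : Fin 3 →₀ ℕ) :
    coeff (A + Finsupp.single 0 (ε₁ * A 1 + ε₂ * A 2)) (substAlgHom (R := k) ha F) = coeff A F := by
  classical
  rw [coe_substAlgHom, coeff_subst ha, finsum_eq_single _ A]
  · rw [prod_pow_eq_monomial h0 h1 h2, coeff_monomial_same, smul_eq_mul, mul_one]
  · intro B hB
    rw [prod_pow_eq_monomial h0 h1 h2, coeff_monomial_ne (fun h => hB (chartExp_injective (ε₁ := ε₁) (ε₂ := ε₂) h).symm),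
      smul_zero]

/-- **`Φ_ε` is injective.** -/
theorem substAlgHom_injective : Function.Injective (substAlgHom (R := k) ha) := by
  intro F G hFG
  ext A
  rw [← coeff_chartExp_substAlgHom ha h0 h1 h2 F A, ← coeff_chartExp_substAlgHom ha h0 h1 h2 G A, hFG]

omit h1 h2 in
/-- **`Φ_ε` fixes the series in `x` alone.** -/
theorem substAlgHom_rename_zero (r : MvPowerSeries (Fin 1) k) :
    substAlgHom (R := k) ha (rename (fun _ : Fin 1 => (0 : Fin 3)) r) = rename (fun _ : Fin 1 => (0 : Fin 3)) r := by
  have hX : HasSubst (X ∘ (fun _ : Fin 1 => (0 : Fin 3)) : Fin 1 → MvPowerSeries (Fin 3) k) :=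
    hasSubst_of_constantCoeff_zero (fun _ => constantCoeff_X _)
  rw [rename_eq_subst, coe_substAlgHom, subst_comp_subst_apply hX ha]
  congr 1
  funext s
  rw [Function.comp_apply, subst_X ha, h0]

omit h1 h2 in
/-- `Φ_ε` fixes `x`. -/
theorem substAlgHom_X_zero : substAlgHom (R := k) ha (X 0) = (X 0 : MvPowerSeries (Fin 3) k) := by rw [substAlgHom_X, h0]

/-- **`Φ_ε` on a box polynomial**: `Σ r_p(x) x^{e_p} v^{i_p} w^{j_p} ↦ Σ r_p(x) x^{e_p + ε₁ i_p + ε₂ j_p} v^{i_p} w^{j_p}`. -/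
theorem substAlgHom_boxSum {ι : Type} [Fintype ι] (c : ι → MvPowerSeries (Fin 1) k) (e i j : ι → ℕ) :
    substAlgHom (R := k) ha (∑ p, rename (fun _ : Fin 1 => (0 : Fin 3)) (c p) * X 0 ^ (e p) * (X 1 ^ (i p) * X 2 ^ (j p))) =
      ∑ p, rename (fun _ : Fin 1 => (0 : Fin 3)) (c p) * X 0 ^ (e p + ε₁ * i p + ε₂ * j p) * (X 1 ^ (i p) * X 2 ^ (j p)) := by
  rw [map_sum]
  refine Finset.sum_congr rfl fun p _ => ?_
  rw [map_mul, map_mul, map_mul, map_pow, map_pow, map_pow, substAlgHom_rename_zero ha h0, substAlgHom_X, substAlgHom_X,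
    substAlgHom_X, h0, h1, h2]
  ring

end Chart

end TOT2Chart

end Summit.ResolutionOfSingularities.ResolutionOfSingularities.Theorems

end
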